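import Literature.AlgebraicGeometry.Resolution.FFinite
import Literature.RingTheory.Flat.NoetherianApproximation
import Mathlib.RingTheory.RingHom.Flat
import Mathlib.RingTheory.Flat.FaithfullyFlat.Algebra
import Mathlib.FieldTheory.IntermediateField.Adjoin.Algebra
import Mathlib.Algebra.CharP.IntermediateField
import Mathlib.Algebra.Algebra.ZMod
import Mathlib.Algebra.Field.ZMod
import Mathlib.FieldTheory.Perfect
import Mathlib.AlgebraicGeometry.Morphisms.FiniteType
import Mathlib.RingTheory.Localization.AtPrime.Basic
import Mathlib.RingTheory.Localization.Basic
import Mathlib.RingTheory.Localization.Submodule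
import HarnessLib

/-!
# Crux `FRationalModification` — Noetherian F-finite submodels of stalks (line `Sketch`, v8)

Support file for crux stmt-ResolutionOfSingularities-15316
(`Summit.ResolutionOfSingularities.ResolutionOfSingularities.Theses.FrobeniusLadder.FRationalModification`,
route `FrobeniusLadder`), stub `stub_stalkSubmodels` of the line lead's skeleton v8.

**Statement** (`stub_stalkSubmodels`). For a scheme `X` locally of finite type over a field `k` of
characteristic `p` (ANY field, not necessarily F-finite) and `x ∈ X`, the stalk `𝒪_{X,x}` has,
through every finite subset `F ⊆ 𝒪_{X,x}`, a faithfully flat Noetherian F-finite submodel: a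
Noetherian ring `S₀` with `IsFFinite p 1 S₀` and an algebra map `S₀ → 𝒪_{X,x}` making `𝒪_{X,x}`
faithfully flat over `S₀`, with `F` in its image.

**Proof** (EGA IV₃ §8 "spreading out", affine-local form; Kunz 1969 §1 for F-finiteness).
* `exists_flat_model`: for a `k`-algebra `A` of finite type, presented as `A = k[x₁, …, x_n]/(f)`,
  and a finite `F ⊆ A`, let `k₀ ⊆ k` be the subfield generated over `𝔽_p` by the coefficients of
  the `fᵢ` and of polynomial lifts of the elements of `F`; `k₀` is the fraction field of an
  `𝔽_p`-algebra of finite type, hence F-finite (`isFFinite_adjoin`: tree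
  `isFFinite_of_finiteType_of_perfectRing`, `IsFFinite.of_isLocalization`). With
  `A₀ := k₀[x]/(f)` the map `A₀ → A` is the base change of `k₀ → k` (tree
  `Literature.RingTheory.Flat.isPushout_quotMap`, Stacks 00R0 (4)), hence flat; `A₀` is Noetherian
  and F-finite (`IsFFinite.of_finiteType`), and its image contains `F`.
* `exists_localRingHom`: for a flat `ψ : A₀ → A` and a prime `𝔭 ⊆ A`, the induced local map
  `(A₀)_{ψ⁻¹𝔭} → A_𝔭` is flat (Mathlib `RingHom.Flat.localRingHom`) and local, hence faithfully
  flat (`Module.FaithfullyFlat.of_flat_of_isLocalHom`); `exists_submodel` assembles the two at a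
  localization `S = A_𝔭`, writing the elements of `F` as fractions.
* `stub_stalkSubmodels`: `𝒪_{X,x} = Γ(X, U)_𝔭` for an affine open neighbourhood `U` of `x`
  (`IsAffineOpen.isLocalization_stalk`), `Γ(X, U)` of finite type over `k`
  (`Scheme.Hom.finiteType_appLE`).
-/

-- single-problem summit: the doubled namespace component `ResolutionOfSingularities` is forced
set_option linter.dupNamespace false

noncomputable section

open CategoryTheory AlgebraicGeometry TopologicalSpace
open IsLocalRing Literature.AlgebraicGeometry.Resolution

namespace Summit.ResolutionOfSingularities.ResolutionOfSingularities.Theorems.FRationalModification.StalkSubmodels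

/-! ## Finitely generated subfields are F-finite -/

open IntermediateField.algebraAdjoinAdjoin in
/-- **A subfield generated over `𝔽_p` by finitely many elements is F-finite**: it is the fraction
field of an `𝔽_p`-algebra of finite type, which is F-finite since `𝔽_p` is perfect (Kunz), and
localisations of F-finite rings are F-finite. [cite: Kunz1969, §1] -/
theorem isFFinite_adjoin (p : ℕ) [Fact p.Prime] {k : Type} [Field k] [CharP k p]
    [Algebra (ZMod p) k] (C : Finset k) :
    IsFFinite p 1 (IntermediateField.adjoin (ZMod p) (C : Set k)) := by
  haveI : Algebra.FiniteType (ZMod p) (Algebra.adjoin (ZMod p) (C : Set k)) :=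
    (Subalgebra.fg_iff_finiteType _).mp (Subalgebra.fg_adjoin_finset C)
  haveI : CharP (Algebra.adjoin (ZMod p) (C : Set k)) p :=
    (algebraMap (Algebra.adjoin (ZMod p) (C : Set k)) k).charP Subtype.val_injective p
  exact (isFFinite_of_finiteType_of_perfectRing (ZMod p) p 1
    (Algebra.adjoin (ZMod p) (C : Set k))).of_isLocalization
    (nonZeroDivisors (Algebra.adjoin (ZMod p) (C : Set k)))
    (IntermediateField.adjoin (ZMod p) (C : Set k))

/-! ## Base change of a quotient of a polynomial ring along a field extension is flat -/

open Literature.RingTheory.Flat in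
/-- **`T[x]/(g) → B[x]/(g)B[x]` is flat for a field `T`**: it is the base change of `T → B`
(tree `isPushout_quotMap`, Stacks 00R0 (4)), and every `T`-module is flat.
[cite: StacksProject, Tag 00R0 (4); folklore] -/
theorem flat_quotMap {T B : Type} [Field T] [CommRing B] [Algebra T B] {n m : ℕ}
    (g : Fin m → MvPolynomial (Fin n) T) (J' : Ideal (MvPolynomial (Fin n) B))
    (hJ' : J' = Ideal.span (Set.range fun i => MvPolynomial.map (algebraMap T B) (g i))) :
    (quotMap g J' hJ').toRingHom.Flat := by
  letI := (quotMap g J' hJ').toRingHom.toAlgebra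
  haveI : IsScalarTower T (MvPolynomial (Fin n) T ⧸ Ideal.span (Set.range g))
      (MvPolynomial (Fin n) B ⧸ J') :=
    IsScalarTower.of_algebraMap_eq fun t => ((quotMap g J' hJ').commutes t).symm
  haveI : Algebra.IsPushout T B (MvPolynomial (Fin n) T ⧸ Ideal.span (Set.range g))
      (MvPolynomial (Fin n) B ⧸ J') :=
    isPushout_quotMap g J' hJ'
  exact RingHom.Flat.isStableUnderBaseChange T B _ _
    (RingHom.flat_algebraMap_iff.mpr inferInstance)

/-! ## A flat Noetherian F-finite model of an algebra of finite type -/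

open Literature.RingTheory.Flat in
/-- **Flat Noetherian F-finite models, given a field of definition.** Let `T → k` be a field
extension with `T` F-finite and `char k = p`, `A = k[x₁, …, x_n]/(f₁, …, f_m)` a nontrivial
quotient (presented by a surjection `φ` with kernel `(f)`) such that the `fᵢ` and lifts of the
elements of a finite `F ⊆ A` have coefficients in `T`. Then `A₀ := T[x]/(f)` is Noetherian, of
characteristic `p`, F-finite (`IsFFinite.of_finiteType`), the induced `ψ : A₀ → A` is flat
(`flat_quotMap`: `A = k ⊗_T A₀`), and `F ⊆ ψ(A₀)`. [cite: EGAIV3, Prop. 8.9.1] -/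
theorem exists_flat_model_of_coeffs (p : ℕ) [Fact p.Prime] {T k A : Type} [Field T] [Field k]
    [CharP k p] [Algebra T k] [CommRing A] [Nontrivial A] [Algebra k A] (hT : IsFFinite p 1 T)
    {n m : ℕ} (φ : MvPolynomial (Fin n) k →ₐ[k] A) (hφ : Function.Surjective φ)
    (f : Fin m → MvPolynomial (Fin n) k) (hf : Ideal.span (Set.range f) = RingHom.ker φ)
    (hfT : ∀ i, f i ∈ Set.range (MvPolynomial.map (algebraMap T k)))
    (F : Finset A)
    (hFT : ∀ a ∈ F, ∃ q ∈ Set.range (MvPolynomial.map (algebraMap T k)), φ q = a) :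
    ∃ (A₀ : Type) (_ : CommRing A₀) (ψ : A₀ →+* A),
      IsNoetherianRing A₀ ∧ CharP A₀ p ∧ IsFFinite p 1 A₀ ∧ ψ.Flat ∧
        (↑F : Set A) ⊆ Set.range ψ := by
  classical
  -- the restricted relations `gᵢ ∈ T[x]`
  choose g hg using hfT
  have hJ : RingHom.ker φ =
      Ideal.span (Set.range fun i => MvPolynomial.map (algebraMap T k) (g i)) := by
    rw [← hf]
    congr 1
    ext q
    simp only [Set.mem_range, hg]
  -- the model `A₀ = T[x]/(g)` and `ψ : A₀ → k[x]/(f) ≅ A` (flat: base change of `T → k`)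
  let ψ : (MvPolynomial (Fin n) T ⧸ Ideal.span (Set.range g)) →+* A :=
    (Ideal.quotientKerAlgEquivOfSurjective hφ).toRingEquiv.toRingHom.comp
      (quotMap g (RingHom.ker φ) hJ).toRingHom
  have hψ_mk : ∀ q : MvPolynomial (Fin n) T,
      ψ (Ideal.Quotient.mk _ q) = φ (MvPolynomial.map (algebraMap T k) q) := fun q => rfl
  have hψ : ψ.Flat :=
    (flat_quotMap g (RingHom.ker φ) hJ).comp
      (RingHom.Flat.of_bijective
        (f := (Ideal.quotientKerAlgEquivOfSurjective hφ).toRingEquiv.toRingHom)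
        (Ideal.quotientKerAlgEquivOfSurjective hφ).bijective)
  haveI : Nontrivial (MvPolynomial (Fin n) T ⧸ Ideal.span (Set.range g)) := ψ.domain_nontrivial
  haveI : CharP T p := (algebraMap T k).charP (algebraMap T k).injective p
  refine ⟨MvPolynomial (Fin n) T ⧸ Ideal.span (Set.range g), inferInstance, ψ, inferInstance,
    charP_of_injective_algebraMap (algebraMap T _).injective p, hT.of_finiteType _, hψ, ?_⟩
  -- the image contains `F`
  intro a ha
  obtain ⟨q, ⟨q₀, hq₀⟩, hqa⟩ := hFT a ha
  exact ⟨Ideal.Quotient.mk _ q₀, by rw [hψ_mk, hq₀, hqa]⟩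

/-- **Flat Noetherian F-finite models** (EGA IV₃ §8, affine form). Let `k` be a field of
characteristic `p`, `A` a nontrivial `k`-algebra of finite type and `F ⊆ A` finite. There is a
Noetherian F-finite ring `A₀` of characteristic `p` with a FLAT ring map `ψ : A₀ → A` whose image
contains `F`: present `A = k[x₁, …, x_n]/(f₁, …, f_m)`, let `k₀ ⊆ k` be the subfield generated over
`𝔽_p` by the coefficients of the `fᵢ` and of lifts of the elements of `F` (F-finite,
`isFFinite_adjoin`), and apply `exists_flat_model_of_coeffs`. [cite: EGAIV3, Prop. 8.9.1] -/
theorem exists_flat_model (p : ℕ) [Fact p.Prime] (k : Type) [Field k] [CharP k p]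
    (A : Type) [CommRing A] [Nontrivial A] [Algebra k A] [Algebra.FiniteType k A]
    (F : Finset A) :
    ∃ (A₀ : Type) (_ : CommRing A₀) (ψ : A₀ →+* A),
      IsNoetherianRing A₀ ∧ CharP A₀ p ∧ IsFFinite p 1 A₀ ∧ ψ.Flat ∧
        (↑F : Set A) ⊆ Set.range ψ := by
  classical
  -- a presentation `A = k[x₁, …, x_n]/(f₁, …, f_m)`
  obtain ⟨n, φ, hφ⟩ :=
    Algebra.FiniteType.iff_quotient_mvPolynomial''.mp ‹Algebra.FiniteType k A›
  obtain ⟨m, f, hf⟩ : ∃ (m : ℕ) (f : Fin m → MvPolynomial (Fin n) k),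
      Ideal.span (Set.range f) = RingHom.ker φ :=
    Submodule.fg_iff_exists_fin_generating_family.mp (IsNoetherian.noetherian _)
  -- polynomial lifts of the elements of `A`
  have hl : ∀ a : A, ∃ q : MvPolynomial (Fin n) k, φ q = a := hφ
  choose l hl using hl
  -- the field of definition `k₀`, generated over `𝔽_p` by finitely many coefficients
  letI : Algebra (ZMod p) k := ZMod.algebra k p
  let C : Finset k :=
    (Finset.univ.biUnion fun i => (f i).coeffs) ∪ F.biUnion fun a => (l a).coeffs
  refine exists_flat_model_of_coeffs p (T := IntermediateField.adjoin (ZMod p) (C : Set k))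
    (isFFinite_adjoin p C) φ hφ f hf (fun i => ?_) F (fun a ha => ?_)
  · refine MvPolynomial.mem_range_map_iff_coeffs_subset.mpr fun c hc => ⟨⟨c, ?_⟩, rfl⟩
    exact IntermediateField.subset_adjoin (ZMod p) (C : Set k)
      (Finset.mem_union_left _ (Finset.mem_biUnion.mpr ⟨i, Finset.mem_univ i, hc⟩))
  · refine ⟨l a, MvPolynomial.mem_range_map_iff_coeffs_subset.mpr fun c hc => ⟨⟨c, ?_⟩, rfl⟩,
      hl a⟩
    exact IntermediateField.subset_adjoin (ZMod p) (C : Set k)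
      (Finset.mem_union_right _ (Finset.mem_biUnion.mpr ⟨a, ha, hc⟩))

/-! ## Localising a flat map at a prime -/

/-- **Localising a flat ring map at a prime.** For a flat `ψ : A₀ → A`, a prime `𝔭 ⊆ A` and a
localization `S` of `A` at `𝔭`, the induced map `θ : (A₀)_{ψ⁻¹ 𝔭} → S` is flat (Mathlib
`RingHom.Flat.localRingHom`) and local, and `θ (a/u) = ψ(a)/ψ(u)`. [folklore] -/
theorem exists_localRingHom {A₀ A S : Type} [CommRing A₀] [CommRing A] [CommRing S]
    (ψ : A₀ →+* A) (hψ : ψ.Flat) (𝔭 : Ideal A) [𝔭.IsPrime] [Algebra A S]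
    [IsLocalization.AtPrime S 𝔭] :
    ∃ θ : Localization.AtPrime (𝔭.comap ψ) →+* S, θ.Flat ∧ IsLocalHom θ ∧
      ∀ (a u : A₀) (hu : ψ u ∉ 𝔭),
        θ (IsLocalization.mk' _ a (⟨u, hu⟩ : (𝔭.comap ψ).primeCompl)) =
          IsLocalization.mk' S (ψ a) (⟨ψ u, hu⟩ : 𝔭.primeCompl) := by
  let e : Localization.AtPrime 𝔭 ≃+* S :=
    (IsLocalization.algEquiv 𝔭.primeCompl (Localization.AtPrime 𝔭) S).toRingEquiv
  let L : Localization.AtPrime (𝔭.comap ψ) →+* Localization.AtPrime 𝔭 :=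
    Localization.localRingHom (𝔭.comap ψ) 𝔭 ψ rfl
  refine ⟨e.toRingHom.comp L, ?_, ?_, ?_⟩
  · exact (hψ.localRingHom 𝔭 (𝔭.comap ψ) rfl).comp (RingHom.Flat.of_bijective e.bijective)
  · constructor
    intro z hz
    change IsUnit (e (L z)) at hz
    exact (isUnit_map_iff L z).mp ((isUnit_map_iff e _).mp hz)
  · intro a u hu
    change e (L (IsLocalization.mk' _ a _)) = _
    simp only [L, Localization.localRingHom_mk', e]
    exact IsLocalization.algEquiv_mk' _ _

/-! ## Submodels of localizations of algebras of finite type -/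

/-- **Faithfully flat Noetherian F-finite submodels of local rings of algebras of finite type.**
Let `k` be a field of characteristic `p`, `A` a nontrivial `k`-algebra of finite type, `𝔭 ⊆ A` a
prime and `S = A_𝔭`. For every finite `F ⊆ S` there is a Noetherian F-finite ring `S₀` and an
algebra map `S₀ → S` making `S` faithfully flat over `S₀`, with `F` in its image:
`S₀ := (A₀)_{ψ⁻¹ 𝔭}` for a flat Noetherian F-finite model `ψ : A₀ → A` containing numerators and
denominators of the elements of `F` (`exists_flat_model`); `S₀ → S` is flat and local, hence
faithfully flat. [cite: EGAIV3, Prop. 8.9.1] -/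
theorem exists_submodel (p : ℕ) [Fact p.Prime] (k : Type) [Field k] [CharP k p]
    (A : Type) [CommRing A] [Nontrivial A] [Algebra k A] [Algebra.FiniteType k A]
    (𝔭 : Ideal A) [𝔭.IsPrime] (S : Type) [CommRing S] [Algebra A S]
    [IsLocalization.AtPrime S 𝔭] (F : Finset S) :
    ∃ (S₀ : Type) (_ : CommRing S₀) (_ : Algebra S₀ S),
      IsNoetherianRing S₀ ∧ IsFFinite p 1 S₀ ∧ Module.FaithfullyFlat S₀ S ∧
        (↑F : Set S) ⊆ Set.range (algebraMap S₀ S) := by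
  classical
  -- numerators and denominators of the elements of `S`
  have hfrac : ∀ z : S, ∃ (a : A) (u : 𝔭.primeCompl), IsLocalization.mk' S a u = z := fun z => by
    obtain ⟨⟨a, u⟩, h⟩ := IsLocalization.mk'_surjective 𝔭.primeCompl z
    exact ⟨a, u, h⟩
  choose num den hnd using hfrac
  let FA : Finset A := F.image num ∪ F.image fun z => (den z : A)
  obtain ⟨A₀, _, ψ, _, _, hA₀, hψ, hFA⟩ := exists_flat_model p k A FA
  obtain ⟨θ, hθ, hθloc, hθmk⟩ := exists_localRingHom ψ hψ 𝔭 (S := S)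
  letI := θ.toAlgebra
  haveI : IsLocalRing S := IsLocalization.AtPrime.isLocalRing S 𝔭
  haveI : Module.Flat (Localization.AtPrime (𝔭.comap ψ)) S := hθ
  haveI : IsLocalHom (algebraMap (Localization.AtPrime (𝔭.comap ψ)) S) := hθloc
  refine ⟨Localization.AtPrime (𝔭.comap ψ), inferInstance, θ.toAlgebra,
    IsLocalization.isNoetherianRing (𝔭.comap ψ).primeCompl _ inferInstance,
    hA₀.of_isLocalization (𝔭.comap ψ).primeCompl _,
    Module.FaithfullyFlat.of_flat_of_isLocalHom, fun z hz => ?_⟩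
  -- the image contains `F`
  have hz' : z ∈ F := hz
  obtain ⟨a₀, ha₀⟩ := hFA (Finset.mem_coe.mpr
    (Finset.mem_union_left _ (Finset.mem_image_of_mem num hz')))
  obtain ⟨u₀, hu₀⟩ := hFA (Finset.mem_coe.mpr
    (Finset.mem_union_right _ (Finset.mem_image_of_mem (fun z => (den z : A)) hz')))
  have hu : ψ u₀ ∉ 𝔭 := by
    rw [hu₀]
    exact (den z).2
  refine ⟨IsLocalization.mk' _ a₀ (⟨u₀, hu⟩ : (𝔭.comap ψ).primeCompl), ?_⟩
  calc θ (IsLocalization.mk' _ a₀ (⟨u₀, hu⟩ : (𝔭.comap ψ).primeCompl))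
        = IsLocalization.mk' S (ψ a₀) (⟨ψ u₀, hu⟩ : 𝔭.primeCompl) := hθmk a₀ u₀ hu
    _ = IsLocalization.mk' S (num z) (den z) := by
      have h2 : (⟨ψ u₀, hu⟩ : 𝔭.primeCompl) = den z := Subtype.ext hu₀
      rw [h2, ha₀]
    _ = z := hnd z

/-! ## The stub: stalks of schemes locally of finite type over a field -/

/-- **STUB `stub_stalkSubmodels`** (EGA IV₃ §8 "spreading out", affine-local form). For a scheme
`X` locally of finite type over a field `k` of characteristic `p` and `x ∈ X`, the stalk `𝒪_{X,x}`
has, through every finite subset `F`, a faithfully flat Noetherian F-finite submodel: a Noetherian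
ring `S₀`, F-finite (`IsFFinite p 1 S₀`), with an algebra map `S₀ → 𝒪_{X,x}` making `𝒪_{X,x}`
faithfully flat over `S₀` and containing `F` in its image. Construction: an affine open
`x ∈ U = Spec A`, `A = k[x₁, …, x_N]/P` of finite type over `k` (`Scheme.Hom.finiteType_appLE`,
`Algebra.FiniteType.iff_quotient_mvPolynomial''`), `𝒪_{X,x} = A_𝔭`
(`IsAffineOpen.isLocalization_stalk`); write the elements of `F` as fractions and choose
polynomial lifts of their numerators and denominators and generators `h₁, …, h_r` of `P`; let
`k₀ ⊆ k` be the subfield generated over `𝔽_p` by all their coefficients — finitely generated over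
the perfect field `𝔽_p`, hence F-finite (`isFFinite_of_finiteType_of_perfectRing`,
`IsFFinite.of_isLocalization`); `A₀ := k₀[x]/(h₁, …, h_r)`, so that `A ≅ k ⊗_{k₀} A₀`
(`Literature.RingTheory.Flat.isPushout_quotMap`) is flat over `A₀` (base change of the field
extension), `A₀` is of finite type over `k₀` hence Noetherian and F-finite
(`IsFFinite.of_finiteType`); finally `S₀ := (A₀)_{𝔭 ∩ A₀} → A_𝔭` is flat
(`RingHom.Flat.localRingHom`) and local, hence faithfully flat
(`Module.FaithfullyFlat.of_flat_of_isLocalHom`), Noetherian and F-finite (localisation).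
[cite: EGAIV3, Prop. 8.9.1; Kunz1969, §1; folklore] -/
theorem stub_stalkSubmodels (p : ℕ) [Fact p.Prime] {k : Type} [Field k] [CharP k p]
    {X : Scheme.{0}} (f : X ⟶ Spec (.of k)) [LocallyOfFiniteType f] (x : X)
    (F : Finset (X.presheaf.stalk x)) :
    ∃ (S₀ : Type) (_ : CommRing S₀) (_ : Algebra S₀ (X.presheaf.stalk x)),
      IsNoetherianRing S₀ ∧ IsFFinite p 1 S₀ ∧ Module.FaithfullyFlat S₀ (X.presheaf.stalk x) ∧
        (↑F : Set (X.presheaf.stalk x)) ⊆ Set.range (algebraMap S₀ (X.presheaf.stalk x)) := by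
  obtain ⟨U, hU, hxU, -⟩ :=
    exists_isAffineOpen_mem_and_subset (X := X) (x := x) (U := ⊤) (Opens.mem_top x)
  -- `Γ(X, U)` is a `k`-algebra of finite type
  have h1 : (f.appLE ⊤ U le_top).hom.FiniteType :=
    f.finiteType_appLE (isAffineOpen_top _) hU le_top
  have h2 : (Scheme.ΓSpecIso (.of k)).inv.hom.FiniteType :=
    RingHom.FiniteType.of_surjective _
      (Scheme.ΓSpecIso (.of k)).symm.commRingCatIsoToRingEquiv.surjective
  let g : k →+* Γ(X, U) := (f.appLE ⊤ U le_top).hom.comp (Scheme.ΓSpecIso (.of k)).inv.hom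
  letI : Algebra k Γ(X, U) := g.toAlgebra
  haveI : Algebra.FiniteType k Γ(X, U) := RingHom.finiteType_algebraMap.mp (h1.comp h2)
  -- `𝒪_{X,x}` is the localisation of `Γ(X, U)` at the prime of `x`
  letI : Algebra Γ(X, U) (X.presheaf.stalk x) :=
    TopCat.Presheaf.algebra_section_stalk X.presheaf (⟨x, hxU⟩ : U)
  haveI := hU.isLocalization_stalk ⟨x, hxU⟩
  -- `Γ(X, U)` is nontrivial (it has the prime of `x`)
  haveI : Nontrivial Γ(X, U) :=
    ⟨⟨0, 1, fun h01 => (hU.primeIdealOf ⟨x, hxU⟩).isPrime.ne_top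
      ((Ideal.eq_top_iff_one _).mpr (h01 ▸ Ideal.zero_mem _))⟩⟩
  exact exists_submodel p k Γ(X, U) (hU.primeIdealOf ⟨x, hxU⟩).asIdeal (X.presheaf.stalk x) F

end Summit.ResolutionOfSingularities.ResolutionOfSingularities.Theorems.FRationalModification.StalkSubmodels

end
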